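import Literature.NumberTheory.EllipticCurves.PadicSigmaThreeChart
import Literature.NumberTheory.EllipticCurves.UniversalOrdinaryRing
import Literature.NumberTheory.EllipticCurves.UniversalSigmaSpecializationProofs
import HarnessLib

/-!
# The universal ordinary `a₂`-family at `p = 3`: the ring `R̂₃ = ℤ[Y, A₄, A₆][1/Y]^₃`, the universal
# chart and curve, unit Hasse coefficients, specialisations (Blakestad–Grant Thm. 15), Frobenius
# congruences (Def. 8), and `K₃ = R̂₃[1/3]` with Thm. 2 over `R̂₃`

Trunk T-NT-EC (Literature/NumberTheory/EllipticCurves). Blakestad–Grant's proof of the integrality of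
the Mazur–Tate sigma function (tree: `UniversalOrdinaryRing`, …, `mazur_tate_sigma_existsUnique_holds`,
`p ≥ 5`) works over the `p`-adic completion `R̂` of `ℤ[A₄, A₆][1/H]` because a Frobenius lift `α` lives
there (a single curve over `ℤ_p` has none). At `p = 3` the short family is empty (`H ≡ 0`); the chart of
`PadicSigmaThreeChart.lean` replaces `(A₄, A₆; H)` by `(Y, A₄, A₆; Y)`. This file builds the base ring
EXACTLY as the tree builds Blakestad–Grant's (same Mathlib objects, same generic completion facts
`Literature.RingTheory.AdicTopology.PrincipalCompletion`), one variable more and with the Hasse polynomial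
replaced by the variable `Y`.
Part `PadicSigmaThreeUniversalRing`: `coeffRing = ℤ[Y, A₄, A₆]` (`MvPolynomial (Fin 3) ℤ`), `Yv`, `A4v`,
`A6v`; `(3)` prime and `Y ∉ (3)`, so `localizedRing = ℤ[Y, A₄, A₆][1/Y]` is a domain with `(3)` prime and
no `3`-torsion; `completeRing = R̂₃`, the `3`-adic completion: `IsAdicComplete (3)`, a DOMAIN, `(3)` prime,
`charP_quotient`, no additive torsion, `Y`, `Y³ + 27A₆` and `2` units; `univY`, `univA4`, `univA6`.
Part `PadicSigmaThreeUniversalChart`: `univChart : Chart R̂₃`, `universalCurve = univChart.curve`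
(`y² = x³ + a₂(Y,A₄,A₆)x² + A₄x + A₆`), whose Hasse coefficient `w₂ = hasseCoeff 3 = 4a₂ ≡ -4Y (mod 3)`
and all `w_{3ⁿ⁺¹-1}` are UNITS (`isUnit_coeff_formalInvDiff_universalCurve[_pow]`, the ordinarity
hypothesis of Blakestad–Grant's Thm. 2 = tree `exists_padicWeierstrassZetaConst`);
`specialize y a₄ a₆ (hy : IsUnit y) : R̂₃ →+* A` into any `3`-adically complete ring (Thm. 15 for the
chart), `ringHom_ext`, and `specialize_sub_pow_mem` — if `y ≡ Y³`, `a₄ ≡ A₄³`, `a₆ ≡ A₆³ (mod 3)` then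
`α = specialize y a₄ a₆` satisfies `α(x) ≡ x³ (mod 3)` for ALL `x` (Def. 8; the hypothesis of Dwork's
lemma `coeff_exp_sigmaExpArg_mem_of_isogeny`).
Part `PadicSigmaThreeUniversalRingQ`: `completeRingQ = K₃ = R̂₃[1/3]` (`Localization.Away 3`),
`intSubring = R̂₃ ⊆ K₃`, `exists_pow_mul_mem_intSubring`, `Algebra ℚ K₃`, `K₃` a domain; `extendQ α :
K₃ → K₃` for an endomorphism `α` of `R̂₃` with `extendQ_mem_intSubring`, `exists_extendQ_eq_pow_add`;
`exists_even_zetaSeries_universalCurve` — Blakestad–Grant's Thm. 2 for the universal ordinary `a₂`-curve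
over `R̂₃`; `exists_ringHom_completeRingQ_padic`, `norm_le_one_of_mem_intSubring` (a specialisation
`ρ : R̂₃ → ℤ₃` extends to `ρ_K : K₃ → ℚ₃` and carries `R̂₃`-coefficients to `3`-integral ones).

## Sources

* C. Blakestad, D. Grant, J. Number Theory 249 (2023) 348–376, §2.1–2.2, Lemma 5, Thm. 2, Def. 8, Thm. 15.
  [BlakestadGrant2023]
* The tree files `UniversalOrdinaryRing.lean`, `UniversalOrdinaryFunctionalEquation.lean`,
  `UniversalSigmaSpecializationProofs.lean` (constructions repeated with `(Fin 3, Y)` for `(Fin 2, H)`).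

Provenance. Re-homed VERBATIM (declaration bodies unchanged; namespaces
`Summit.BirchSwinnertonDyer.Rank1Residual.X1.PadicSigmaThree[.Universal]` ↦
`Literature.NumberTheory.EllipticCurves.PadicSigmaThree[.Universal]`, intra-tower imports re-pointed)
from `Summits/BirchSwinnertonDyer/Rank1Residual/X1/PadicSigmaThree*.lean` (cell `b2b-bsdres`, unit x1a,
2026-08-22), so that the discharge `Literature.NumberTheory.EllipticCurves.mazur_tate_sigma_exists_odd_holds`
of the Literature named fact `mazur_tate_sigma_exists_odd` (`PadicSigmaOddPrime.lean`) lives in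
`Literature/` (which cannot import `Summits/`; ledger promote event 10878647). The `Summits/…/X1` copies are
thereby refactor debt (to be re-pointed at these modules by a librarian); nothing here is new mathematics
relative to them.

Design notes. Definitions (all with bodies): `coeffRing`, `Yv`, `A4v`, `A6v`, `localizedRing`,
`completeRing`, `univY`, `univA4`, `univA6`, `univChart`, `universalCurve`, `specializeAway`, `specialize`,
`completeRingQ`, `intSubring`, `extendQ`, `ratCast`; instances only on the NEW concrete types
`localizedRing` / `completeRing` / `completeRingQ` defined here (domain, adic completeness, torsion-freeness,
`Algebra ℚ`), exactly as in the tree's `UniversalOrdinaryRing.lean`. No named facts, no `sorry`. Three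
consecutive `noncomputable section … end` blocks.
-/

/-! ## Part `PadicSigmaThreeUniversalRing` (= `Summits/BirchSwinnertonDyer/Rank1Residual/X1/PadicSigmaThreeUniversalRing.lean`, declarations verbatim) -/

noncomputable section

open Polynomial

namespace Literature.NumberTheory.EllipticCurves.PadicSigmaThree.Universal

open Literature.RingTheory.AdicTopology Literature.NumberTheory.EllipticCurves

/-! ## `ℤ[Y, A₄, A₆]` -/

/-- **`ℤ[Y, A₄, A₆]`**, the coefficient ring of the chart. [cite: BlakestadGrant2023, §2.1] -/
abbrev coeffRing : Type := MvPolynomial (Fin 3) ℤ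

/-- The variable `Y` (`= 3·x(P)`). [cite: BlakestadGrant2023, §2.1] -/
def Yv : coeffRing := MvPolynomial.X 0

/-- The variable `A₄`. [cite: BlakestadGrant2023, §2.1] -/
def A4v : coeffRing := MvPolynomial.X 1

/-- The variable `A₆`. [cite: BlakestadGrant2023, §2.1] -/
def A6v : coeffRing := MvPolynomial.X 2

/-- The kernel of reduction `ℤ[Y,A₄,A₆] → 𝔽_p[Y,A₄,A₆]` is `(p)`. [cite: BlakestadGrant2023, §2.1] -/
theorem ker_map_castRingHom (p : ℕ) :
    RingHom.ker (MvPolynomial.map (σ := Fin 3) (Int.castRingHom (ZMod p))) = Ideal.span {(p : coeffRing)} := by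
  rw [MvPolynomial.ker_map, ZMod.ker_intCastRingHom, Ideal.map_span, Set.image_singleton, map_natCast]

/-- `(p)` is a prime ideal of `ℤ[Y, A₄, A₆]`. [cite: BlakestadGrant2023, §2.1] -/
theorem span_natCast_isPrime (p : ℕ) [Fact p.Prime] : (Ideal.span {(p : coeffRing)}).IsPrime := by
  rw [← ker_map_castRingHom]
  exact RingHom.ker_isPrime _

/-- `Y ≢ 0 (mod p)` (a variable). [cite: BlakestadGrant2023, §2.1] -/
theorem Yv_map_ne_zero (p : ℕ) [Fact p.Prime] : MvPolynomial.map (Int.castRingHom (ZMod p)) Yv ≠ 0 := by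
  rw [Yv, MvPolynomial.map_X]
  exact MvPolynomial.X_ne_zero _

/-- `Y ≠ 0`. [cite: BlakestadGrant2023, §2.1] -/
theorem Yv_ne_zero : Yv ≠ 0 := by
  rw [Yv]; exact MvPolynomial.X_ne_zero _

/-- `Y ∉ (p)`. [cite: BlakestadGrant2023, §2.1] -/
theorem Yv_not_mem_span (p : ℕ) [Fact p.Prime] : Yv ∉ Ideal.span {(p : coeffRing)} := by
  rw [← ker_map_castRingHom, RingHom.mem_ker]
  exact Yv_map_ne_zero p

/-- The powers of `Y` avoid `(p)`. [cite: BlakestadGrant2023, §2.1] -/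
theorem disjoint_powers_Yv_span (p : ℕ) [Fact p.Prime] :
    Disjoint (Submonoid.powers Yv : Set coeffRing) ↑(Ideal.span {(p : coeffRing)}) := by
  rw [Set.disjoint_left]
  rintro x ⟨k, rfl⟩ hx
  exact Yv_not_mem_span p ((span_natCast_isPrime p).mem_of_pow_mem k hx)

/-- `p ≠ 0` in `ℤ[Y, A₄, A₆]`. [folklore] -/
private theorem natCast_ne_zero {p : ℕ} (hp : p ≠ 0) : (p : coeffRing) ≠ 0 := by
  rw [← map_natCast (MvPolynomial.C : ℤ →+* coeffRing), Ne, MvPolynomial.C_eq_zero, Nat.cast_eq_zero]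
  exact hp

/-! ## `ℤ[Y, A₄, A₆][1/Y]` -/

/-- **`ℤ[Y, A₄, A₆][1/Y]`**. [cite: BlakestadGrant2023, §2.1] -/
abbrev localizedRing : Type := Localization.Away Yv

/-- `ℤ[Y,A₄,A₆][1/Y]` is a domain. [folklore] -/
instance isDomain_localizedRing : IsDomain localizedRing :=
  IsLocalization.isDomain_localization (powers_le_nonZeroDivisors_of_noZeroDivisors Yv_ne_zero)

/-- `ℤ[Y,A₄,A₆] → ℤ[Y,A₄,A₆][1/Y]` is injective. [cite: BlakestadGrant2023, §2.1] -/
theorem algebraMap_localizedRing_injective : Function.Injective (algebraMap coeffRing localizedRing) :=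
  IsLocalization.injective localizedRing (powers_le_nonZeroDivisors_of_noZeroDivisors Yv_ne_zero)

/-- `(p)` is a prime ideal of `ℤ[Y,A₄,A₆][1/Y]`. [cite: BlakestadGrant2023, §2.1] -/
theorem span_natCast_isPrime_localizedRing (p : ℕ) [Fact p.Prime] :
    (Ideal.span {(p : localizedRing)}).IsPrime := by
  have h := IsLocalization.isPrime_of_isPrime_disjoint (Submonoid.powers Yv) localizedRing
    (Ideal.span {(p : coeffRing)}) (span_natCast_isPrime p) (disjoint_powers_Yv_span p)
  rwa [Ideal.map_span, Set.image_singleton, map_natCast] at h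

/-- `ℤ[Y,A₄,A₆][1/Y]` has no `p`-torsion. [cite: BlakestadGrant2023, §2.1] -/
theorem eq_zero_of_natCast_mul_eq_zero (p : ℕ) [Fact p.Prime] (x : localizedRing)
    (hx : (p : localizedRing) * x = 0) : x = 0 := by
  have hp0 : (p : localizedRing) ≠ 0 := by
    rw [← map_natCast (algebraMap coeffRing localizedRing), Ne, ← (algebraMap coeffRing localizedRing).map_zero,
      algebraMap_localizedRing_injective.eq_iff]
    exact natCast_ne_zero (Fact.out : p.Prime).ne_zero
  exact (mul_eq_zero.mp hx).resolve_left hp0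

/-- `Y` is a unit of `ℤ[Y,A₄,A₆][1/Y]`. [cite: BlakestadGrant2023, §2.1] -/
theorem isUnit_algebraMap_Yv : IsUnit (algebraMap coeffRing localizedRing Yv) :=
  IsLocalization.Away.algebraMap_isUnit Yv

/-! ## `R̂₃`, the `3`-adic completion -/

/-- **`R̂₃`, the `3`-adic completion of `ℤ[Y, A₄, A₆][1/Y]`** — the base of the universal ordinary
`a₂`-family at `p = 3`. [cite: BlakestadGrant2023, §2.1] -/
abbrev completeRing : Type := AdicCompletion (Ideal.span {((3 : ℕ) : localizedRing)}) localizedRing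

/-- `R̂₃` is `3`-adically complete. [folklore] -/
instance isAdicComplete_completeRing : IsAdicComplete (Ideal.span {((3 : ℕ) : completeRing)}) completeRing :=
  isAdicComplete_span_natCast localizedRing 3

/-- The same instance with the literal `3`. [folklore] -/
instance isAdicComplete_completeRing' : IsAdicComplete (Ideal.span {(3 : completeRing)}) completeRing :=
  isAdicComplete_span_natCast localizedRing 3

/-- `ℤ[Y,A₄,A₆] → R̂₃` factors through the localisation. [cite: BlakestadGrant2023, §2.1] -/
theorem algebraMap_coeffRing_apply (q : coeffRing) :
    algebraMap coeffRing completeRing q = algebraMap localizedRing completeRing (algebraMap coeffRing localizedRing q) := by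
  rw [AdicCompletion.algebraMap_apply, AdicCompletion.algebraMap_apply, Algebra.algebraMap_self, RingHom.id_apply]

/-- `Y ∈ R̂₃`. [cite: BlakestadGrant2023, §2.1] -/
def univY : completeRing := algebraMap coeffRing completeRing Yv

/-- `A₄ ∈ R̂₃`. [cite: BlakestadGrant2023, §2.1] -/
def univA4 : completeRing := algebraMap coeffRing completeRing A4v

/-- `A₆ ∈ R̂₃`. [cite: BlakestadGrant2023, §2.1] -/
def univA6 : completeRing := algebraMap coeffRing completeRing A6v

/-- **`Y` is a unit of `R̂₃`.** [cite: BlakestadGrant2023, §2.1] -/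
theorem isUnit_univY : IsUnit univY := by
  rw [univY, algebraMap_coeffRing_apply]
  exact isUnit_algebraMap_Yv.map _

/-- `3` is prime (instance for the `p`-adic API). [folklore] -/
instance fact_prime_three : Fact (Nat.Prime 3) := ⟨Nat.prime_three⟩

/-- `(3) ⊂ R̂₃` is prime. [cite: BlakestadGrant2023, §2.1] -/
theorem span_natCast_isPrime_completeRing : (Ideal.span {(3 : completeRing)}).IsPrime := by
  haveI := span_natCast_isPrime_localizedRing 3
  have h := span_algebraMap_isPrime ((3 : ℕ) : localizedRing)
  rwa [algebraMap_natCast, Nat.cast_ofNat] at h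

/-- **`R̂₃` is an integral domain.** [cite: BlakestadGrant2023, §2.2] -/
instance isDomain_completeRing : IsDomain completeRing :=
  haveI := span_natCast_isPrime_localizedRing 3
  isDomain_natCast localizedRing 3 (eq_zero_of_natCast_mul_eq_zero 3)

/-- `3` is not a unit of `R̂₃`. [cite: BlakestadGrant2023, §2.1] -/
theorem three_mem_nonunits : (3 : completeRing) ∈ nonunits completeRing :=
  fun hu => span_natCast_isPrime_completeRing.ne_top
    (Ideal.eq_top_of_isUnit_mem _ (Ideal.mem_span_singleton_self _) hu)

/-- `R̂₃/(3)` has characteristic `3`. [cite: BlakestadGrant2023, §2.1] -/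
theorem charP_quotient : CharP (completeRing ⧸ Ideal.span {(3 : completeRing)}) 3 :=
  CharP.quotient completeRing 3 three_mem_nonunits

/-- `3ᵏ x = 0 ↔ x = 0` in `R̂₃`. [cite: BlakestadGrant2023, §2.1] -/
theorem pow_mul_eq_zero_iff_completeRing (k : ℕ) (x : completeRing) : ((3 : ℕ) : completeRing) ^ k * x = 0 ↔ x = 0 :=
  natCast_pow_mul_eq_zero_iff localizedRing 3 (eq_zero_of_natCast_mul_eq_zero 3) k x

/-- **`R̂₃` has no additive torsion.** [folklore] -/
instance isAddTorsionFree_completeRing : IsAddTorsionFree completeRing := by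
  refine ⟨fun n hn a b hab => ?_⟩
  have h0 : (n : completeRing) * (a - b) = 0 := by
    have hab' : n • a = n • b := hab
    rw [mul_sub, ← nsmul_eq_mul, ← nsmul_eq_mul, hab', sub_self]
  obtain ⟨k, m, hm, rfl⟩ := Nat.exists_eq_pow_mul_and_not_dvd hn 3 (by norm_num)
  have hmu : IsUnit (m : completeRing) :=
    isUnit_natCast_of_coprime (p := 3) ((Nat.Prime.coprime_iff_not_dvd Nat.prime_three).mpr hm).symm
  rw [Nat.cast_mul, Nat.cast_pow, mul_assoc, pow_mul_eq_zero_iff_completeRing,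
    hmu.mul_right_eq_zero, sub_eq_zero] at h0
  exact h0

/-- `R̂₃` is `3`-adically separated: `(∀ n, c ∈ (3^{n+1})) → c = 0` (the hypothesis `hsep` of the tree's
Prop. 13(a)). [cite: BlakestadGrant2023, §2.1] -/
theorem eq_zero_of_forall_mem_pow (c : completeRing) (h : ∀ n : ℕ, c ∈ Ideal.span {(3 : completeRing) ^ (n + 1)}) :
    c = 0 := by
  refine IsHausdorff.haus' (I := Ideal.span {(3 : completeRing)}) c fun n => ?_
  rw [SModEq.zero, smul_eq_mul, Ideal.mul_top, Ideal.span_singleton_pow]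
  rcases n with _ | n
  · rw [pow_zero, Ideal.span_singleton_one]; exact Submodule.mem_top
  · exact h n

/-- `2` is a unit of `R̂₃`. [cite: BlakestadGrant2023, §2.1] -/
theorem isUnit_two : IsUnit (2 : completeRing) :=
  isUnit_natCast_of_coprime (R := completeRing) (p := 3) (m := 2) (by norm_num)

/-- **`Y³ + 27A₆` is a unit of `R̂₃`** (`≡ Y³ (mod 3)`). [cite: BlakestadGrant2023, §2.1] -/
theorem isUnit_E : IsUnit (univY ^ 3 + 27 * univA6) := by
  refine isUnit_of_isUnit_mk (Ideal.span {(3 : completeRing)}) ?_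
  have h27 : Ideal.Quotient.mk (Ideal.span {(3 : completeRing)}) (27 * univA6) = 0 :=
    Ideal.Quotient.eq_zero_iff_mem.mpr (Ideal.mem_span_singleton.mpr ⟨9 * univA6, by ring⟩)
  rw [map_add, h27, add_zero, map_pow]
  exact (isUnit_univY.map _).pow 3

end Literature.NumberTheory.EllipticCurves.PadicSigmaThree.Universal

end

/-! ## Part `PadicSigmaThreeUniversalChart` (= `Summits/BirchSwinnertonDyer/Rank1Residual/X1/PadicSigmaThreeUniversalChart.lean`, declarations verbatim) -/

noncomputable section

open Polynomial

namespace Literature.NumberTheory.EllipticCurves.PadicSigmaThree.Universal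

open Literature.RingTheory.AdicTopology Literature.NumberTheory.EllipticCurves

/-! ## The universal chart and the universal curve -/

/-- **The universal chart over `R̂₃`**: `(Y, A₄, A₆)` with the inverses of `Y`, `Y³ + 27A₆`, `2`.
[cite: BlakestadGrant2023, §2.1] -/
def univChart : Chart completeRing where
  Y := univY
  A4 := univA4
  A6 := univA6
  yi := ↑(isUnit_univY.unit⁻¹)
  ei := ↑(isUnit_E.unit⁻¹)
  i2 := ↑(isUnit_two.unit⁻¹)
  Y_mul_yi := isUnit_univY.mul_val_inv
  E_mul_ei := isUnit_E.mul_val_inv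
  two_mul_i2 := isUnit_two.mul_val_inv

/-- `univChart.Y = Y`. [cite: BlakestadGrant2023, §2.1] -/
@[simp] theorem univChart_Y : univChart.Y = univY := rfl
/-- `univChart.A4 = A₄`. [cite: BlakestadGrant2023, §2.1] -/
@[simp] theorem univChart_A4 : univChart.A4 = univA4 := rfl
/-- `univChart.A6 = A₆`. [cite: BlakestadGrant2023, §2.1] -/
@[simp] theorem univChart_A6 : univChart.A6 = univA6 := rfl

/-- **The universal ordinary `a₂`-curve `𝓔 : y² = x³ + a₂(Y,A₄,A₆)x² + A₄x + A₆` over `R̂₃`.**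
[cite: BlakestadGrant2023, §2.1] -/
abbrev universalCurve : WeierstrassCurve completeRing := univChart.curve

/-- The Hasse coefficient at `3` of an `a₂`-model is `b₂ = 4a₂`. [cite: BlakestadGrant2023, §2.1] -/
theorem hasseCoeff_three {A : Type*} [CommRing A] (c : Chart A) : c.curve.hasseCoeff 3 = 4 * c.a2 := by
  rw [WeierstrassCurve.hasseCoeff, show (3 - 1) / 2 = 1 from rfl, show 3 - 1 = 2 from rfl, pow_one, Cubic.coeff_eq_b]
  simp [WeierstrassCurve.twoTorsionPolynomial, WeierstrassCurve.b₂]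

/-- `4a₂ = 4Y·(-1) + 3·(…)`: the Hasse coefficient is `≡ -4Y (mod 3)`. [cite: BlakestadGrant2023, §2.1] -/
theorem four_mul_a2_eq {A : Type*} [CommRing A] (c : Chart A) :
    4 * c.a2 = -(4 * c.Y) + 3 * ((c.Y ^ 2 - 3 * c.A4) ^ 2 * c.ei * (4 * c.i2 ^ 2)) := by
  linear_combination 4 * c.a2_add_Y

/-- **The Hasse coefficient `w₂` of `ω_𝓔` is a unit of `R̂₃`** (ordinarity of the universal family;
`w₂ ≡ hasseCoeff 3 = 4a₂ ≡ -4Y (mod 3)`). [cite: BlakestadGrant2023, Prop. 3] -/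
theorem isUnit_coeff_formalInvDiff_universalCurve : IsUnit (PowerSeries.coeff (3 - 1) universalCurve.formalInvDiff) := by
  rw [← UniversalOrdinary.isUnit_hasseCoeff_iff_isUnit_coeff_formalInvDiff 3 (by norm_num), hasseCoeff_three,
    four_mul_a2_eq]
  refine isUnit_of_isUnit_mk (Ideal.span {(3 : completeRing)}) ?_
  have h3 : Ideal.Quotient.mk (Ideal.span {(3 : completeRing)})
      (3 * ((univChart.Y ^ 2 - 3 * univChart.A4) ^ 2 * univChart.ei * (4 * univChart.i2 ^ 2))) = 0 :=
    Ideal.Quotient.eq_zero_iff_mem.mpr (Ideal.mem_span_singleton.mpr (dvd_mul_right _ _))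
  rw [map_add, h3, add_zero, map_neg, IsUnit.neg_iff, map_mul]
  exact ((isUnit_two.pow 2).map _ |>.mul (isUnit_univY.map _)) |> fun h => by
    simpa only [map_pow, show ((2 : completeRing) ^ 2) = 4 by norm_num, univChart_Y] using h

/-- All the Hasse coefficients `w_{3ⁿ⁺¹-1}` of `ω_𝓔` are units. [cite: BlakestadGrant2023, Prop. 3] -/
theorem isUnit_coeff_formalInvDiff_universalCurve_pow (n : ℕ) :
    IsUnit (PowerSeries.coeff (3 ^ (n + 1) - 1) universalCurve.formalInvDiff) :=
  universalCurve.isUnit_coeff_formalInvDiff_prime_pow_sub_one 3 (by norm_num) isUnit_coeff_formalInvDiff_universalCurve n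

/-! ## Specialisation (Blakestad–Grant Thm 15) and endomorphisms (Def 8) -/

section Specialize

variable {A : Type*} [CommRing A] (y a₄ a₆ : A) (hy : IsUnit y)

/-- `ℤ[Y,A₄,A₆][1/Y] → A`, `(Y, A₄, A₆) ↦ (y, a₄, a₆)` for a unit `y`. [cite: BlakestadGrant2023, Thm. 15] -/
def specializeAway : localizedRing →+* A :=
  IsLocalization.Away.lift Yv (g := MvPolynomial.eval₂Hom (Int.castRingHom A) ![y, a₄, a₆])
    (by rwa [Yv, MvPolynomial.coe_eval₂Hom, MvPolynomial.eval₂_X])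

/-- `specializeAway` on `ℤ[Y,A₄,A₆]` is evaluation. [cite: BlakestadGrant2023, Thm. 15] -/
theorem specializeAway_algebraMap (q : coeffRing) :
    specializeAway y a₄ a₆ hy (algebraMap coeffRing localizedRing q) = MvPolynomial.eval₂Hom (Int.castRingHom A) ![y, a₄, a₆] q :=
  IsLocalization.Away.lift_eq Yv _ q

variable [IsAdicComplete (Ideal.span {((3 : ℕ) : A)}) A]

/-- **The specialisation `ρ : R̂₃ → A`, `(Y, A₄, A₆) ↦ (y, a₄, a₆)`** into a `3`-adically complete ring
(`y` a unit). [cite: BlakestadGrant2023, Thm. 15] -/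
def specialize : completeRing →+* A :=
  liftNatCast localizedRing 3 (specializeAway y a₄ a₆ hy)

/-- `ρ` on `ℤ[Y,A₄,A₆]` is evaluation. [cite: BlakestadGrant2023, Thm. 15] -/
theorem specialize_algebraMap (q : coeffRing) :
    specialize y a₄ a₆ hy (algebraMap coeffRing completeRing q) = MvPolynomial.eval₂Hom (Int.castRingHom A) ![y, a₄, a₆] q := by
  rw [algebraMap_coeffRing_apply, specialize, liftNatCast_algebraMap, specializeAway_algebraMap]

/-- `ρ(Y) = y`. [cite: BlakestadGrant2023, Thm. 15] -/
theorem specialize_univY : specialize y a₄ a₆ hy univY = y := by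
  rw [univY, specialize_algebraMap, Yv, MvPolynomial.coe_eval₂Hom, MvPolynomial.eval₂_X]; rfl

/-- `ρ(A₄) = a₄`. [cite: BlakestadGrant2023, Thm. 15] -/
theorem specialize_univA4 : specialize y a₄ a₆ hy univA4 = a₄ := by
  rw [univA4, specialize_algebraMap, A4v, MvPolynomial.coe_eval₂Hom, MvPolynomial.eval₂_X]; rfl

/-- `ρ(A₆) = a₆`. [cite: BlakestadGrant2023, Thm. 15] -/
theorem specialize_univA6 : specialize y a₄ a₆ hy univA6 = a₆ := by
  rw [univA6, specialize_algebraMap, A6v, MvPolynomial.coe_eval₂Hom, MvPolynomial.eval₂_X]; rfl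

end Specialize

/-- **Ring maps out of `R̂₃` into a `3`-adically separated ring are determined by the images of
`Y, A₄, A₆`.** [cite: BlakestadGrant2023, Thm. 15] -/
theorem ringHom_ext {B : Type*} [CommRing B] [IsHausdorff (Ideal.span {((3 : ℕ) : B)}) B]
    {ψ ψ' : completeRing →+* B} (hY : ψ univY = ψ' univY) (h4 : ψ univA4 = ψ' univA4) (h6 : ψ univA6 = ψ' univA6) :
    ψ = ψ' := by
  refine ringHom_ext_natCast (R := localizedRing) 3 fun r => ?_
  suffices hcomp : ψ.comp (algebraMap localizedRing completeRing) = ψ'.comp (algebraMap localizedRing completeRing) from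
    RingHom.congr_fun hcomp r
  refine IsLocalization.ringHom_ext (Submonoid.powers Yv) ?_
  refine MvPolynomial.ringHom_ext (fun n => by simp only [eq_intCast, map_intCast]) fun i => ?_
  simp only [RingHom.comp_apply, ← algebraMap_coeffRing_apply]
  fin_cases i
  · exact hY
  · exact h4
  · exact h6

/-- **Frobenius congruences on `ℤ[Y, A₄, A₆]`**: if `I ∋ p` and `b_j ≡ φ(X_j)ᵖ (mod I)` for the three
variables, then evaluation at `b` is congruent to `φ(·)ᵖ` modulo `I` on all of `ℤ[Y,A₄,A₆]`. [cite: BlakestadGrant2023, Def. 8] -/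
theorem eval₂Hom_sub_pow_mem (p : ℕ) [Fact p.Prime] {B : Type*} [CommRing B] (φ : coeffRing →+* B) (b : Fin 3 → B)
    (I : Ideal B) (hpI : (p : B) ∈ I) (hb : ∀ i, b i - φ (MvPolynomial.X i) ^ p ∈ I) (q : coeffRing) :
    MvPolynomial.eval₂Hom (Int.castRingHom B) b q - φ q ^ p ∈ I := by
  have hp : p.Prime := Fact.out
  induction q using MvPolynomial.induction_on with
  | C r =>
    rw [MvPolynomial.coe_eval₂Hom, MvPolynomial.eval₂_C, eq_intCast, eq_intCast, map_intCast]
    have hdvd : (p : ℤ) ∣ r - r ^ p := by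
      rw [← ZMod.intCast_zmod_eq_zero_iff_dvd, Int.cast_sub, Int.cast_pow, ZMod.pow_card, sub_self]
    obtain ⟨c, hc⟩ := hdvd
    have e : ((r : B) - (r : B) ^ p) = (p : B) * (c : B) := by exact_mod_cast congrArg (Int.cast (R := B)) hc
    rw [e]
    exact I.mul_mem_right _ hpI
  | add q₁ q₂ ih₁ ih₂ =>
    obtain ⟨c, hc⟩ := exists_add_pow_prime_eq hp (φ q₁) (φ q₂)
    have e : MvPolynomial.eval₂Hom (Int.castRingHom B) b (q₁ + q₂) - φ (q₁ + q₂) ^ p =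
        (MvPolynomial.eval₂Hom (Int.castRingHom B) b q₁ - φ q₁ ^ p) +
        (MvPolynomial.eval₂Hom (Int.castRingHom B) b q₂ - φ q₂ ^ p) - (p : B) * φ q₁ * φ q₂ * c := by
      rw [map_add, map_add, hc]; ring
    rw [e]
    exact sub_mem (add_mem ih₁ ih₂) (I.mul_mem_right _ (I.mul_mem_right _ (I.mul_mem_right _ hpI)))
  | mul_X q i ih =>
    have e : MvPolynomial.eval₂Hom (Int.castRingHom B) b (q * MvPolynomial.X i) - φ (q * MvPolynomial.X i) ^ p =
        (MvPolynomial.eval₂Hom (Int.castRingHom B) b q - φ q ^ p) * b i + φ q ^ p * (b i - φ (MvPolynomial.X i) ^ p) := by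
      rw [map_mul, map_mul, MvPolynomial.coe_eval₂Hom, MvPolynomial.eval₂_X, mul_pow]; ring
    rw [e]
    exact add_mem (I.mul_mem_right _ ih) (I.mul_mem_left _ (hb i))

/-- **An endomorphism `α = specialize y a₄ a₆` of `R̂₃` with `y ≡ Y³`, `a₄ ≡ A₄³`, `a₆ ≡ A₆³ (mod 3)`
reduces to the Frobenius: `α(x) ≡ x³ (mod 3)` for all `x ∈ R̂₃`** (Blakestad–Grant Def. 8: the
congruence holds on `ℤ[Y,A₄,A₆]`, passes to the localisation because `α` of a power of `Y` is a unit,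
and to the completion by `sub_pow_mem_span_of_forall_algebraMap`). [cite: BlakestadGrant2023, Def. 8] -/
theorem specialize_sub_pow_mem (y a₄ a₆ : completeRing) (hy : IsUnit y)
    (hY : y - univY ^ 3 ∈ Ideal.span {(3 : completeRing)}) (h4 : a₄ - univA4 ^ 3 ∈ Ideal.span {(3 : completeRing)})
    (h6 : a₆ - univA6 ^ 3 ∈ Ideal.span {(3 : completeRing)}) (x : completeRing) :
    specialize y a₄ a₆ hy x - x ^ 3 ∈ Ideal.span {(3 : completeRing)} := by
  set I := Ideal.span {(3 : completeRing)} with hI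
  set f := specializeAway y a₄ a₆ hy with hf
  set u := algebraMap localizedRing completeRing with hu
  -- on `ℤ[Y, A₄, A₆]`
  have hpoly : ∀ q : coeffRing, MvPolynomial.eval₂Hom (Int.castRingHom completeRing) ![y, a₄, a₆] q -
      algebraMap coeffRing completeRing q ^ 3 ∈ I := by
    intro q
    refine eval₂Hom_sub_pow_mem 3 (algebraMap coeffRing completeRing) ![y, a₄, a₆] I
      (Ideal.mem_span_singleton_self _) (fun i => ?_) q
    fin_cases i
    · exact hY
    · exact h4
    · exact h6
  -- on the localisation
  have hloc : ∀ z : localizedRing, f z - u z ^ 3 ∈ I := by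
    intro z
    obtain ⟨⟨q, s⟩, hqs⟩ := IsLocalization.surj (Submonoid.powers Yv) z
    simp only at hqs
    have hsu : IsUnit (algebraMap coeffRing localizedRing (s : coeffRing)) := IsLocalization.map_units localizedRing s
    have hunit : IsUnit (f (algebraMap coeffRing localizedRing s)) := hsu.map f
    have hc : f (algebraMap coeffRing localizedRing q) - u (algebraMap coeffRing localizedRing q) ^ 3 ∈ I := by
      rw [hf, specializeAway_algebraMap, hu, ← algebraMap_coeffRing_apply]; exact hpoly q
    have hs : f (algebraMap coeffRing localizedRing s) - u (algebraMap coeffRing localizedRing s) ^ 3 ∈ I := by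
      rw [hf, specializeAway_algebraMap, hu, ← algebraMap_coeffRing_apply]; exact hpoly s
    have e : (f z - u z ^ 3) * f (algebraMap coeffRing localizedRing s) =
        (f (algebraMap coeffRing localizedRing q) - u (algebraMap coeffRing localizedRing q) ^ 3) +
          u z ^ 3 * (u (algebraMap coeffRing localizedRing s) ^ 3 - f (algebraMap coeffRing localizedRing s)) := by
      have h1 : f z * f (algebraMap coeffRing localizedRing s) = f (algebraMap coeffRing localizedRing q) := by
        rw [← map_mul, hqs]
      have h2 : u z ^ 3 * u (algebraMap coeffRing localizedRing s) ^ 3 = u (algebraMap coeffRing localizedRing q) ^ 3 := by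
        rw [← mul_pow, ← map_mul, hqs]
      rw [sub_mul, h1, ← h2]; ring
    rw [← Ideal.mul_unit_mem_iff_mem I hunit, e]
    exact add_mem hc (I.mul_mem_left _ (by rw [← neg_sub]; exact I.neg_mem hs))
  -- on the completion
  have h := sub_pow_mem_span_of_forall_algebraMap ((3 : ℕ) : localizedRing) 3 (specialize y a₄ a₆ hy) ?_ ?_ x
  · rw [algebraMap_natCast] at h
    exact h
  · rw [algebraMap_natCast, map_natCast]; exact Ideal.mem_span_singleton_self _
  · intro z
    rw [algebraMap_natCast, specialize, liftNatCast_algebraMap]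
    exact hloc z

end Literature.NumberTheory.EllipticCurves.PadicSigmaThree.Universal

end

/-! ## Part `PadicSigmaThreeUniversalRingQ` (= `Summits/BirchSwinnertonDyer/Rank1Residual/X1/PadicSigmaThreeUniversalRingQ.lean`, declarations verbatim) -/

noncomputable section

open PowerSeries

namespace Literature.NumberTheory.EllipticCurves.PadicSigmaThree.Universal

open Literature.RingTheory.AdicTopology Literature.NumberTheory.EllipticCurves

/-! ## `K₃ = R̂₃[1/3]` -/

/-- **`K₃ = R̂₃[1/3]`**. [cite: BlakestadGrant2023, §2.2] -/
abbrev completeRingQ : Type := Localization.Away (3 : completeRing)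

/-- `3` is a unit of `K₃`. [cite: BlakestadGrant2023, §2.2 (K = R̂[1/p])] -/
theorem isUnit_three_completeRingQ : IsUnit (3 : completeRingQ) := by
  have h := IsLocalization.Away.algebraMap_isUnit (S := completeRingQ) (3 : completeRing)
  rwa [map_ofNat] at h

/-- **`R̂₃ ⊆ K₃`** (the range of `R̂₃ → K₃`). [cite: BlakestadGrant2023, §2.2] -/
abbrev intSubring : Subring completeRingQ := (algebraMap completeRing completeRingQ).range

/-- `K₃ = R̂₃[1/3]`: every element becomes integral after multiplication by a power of `3`. [cite: BlakestadGrant2023, §2.2 (K = R̂[1/p])] -/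
theorem exists_pow_mul_mem_intSubring (x : completeRingQ) : ∃ k : ℕ, (3 : completeRingQ) ^ k * x ∈ intSubring := by
  obtain ⟨⟨r, s⟩, h⟩ := IsLocalization.surj (Submonoid.powers (3 : completeRing)) x
  obtain ⟨k, hk⟩ := s.2
  refine ⟨k, r, ?_⟩
  simp only at h
  rw [mul_comm, ← h, ← hk, map_pow, map_ofNat]

/-- The same with `((3 : ℕ) : K₃)` (the form of the tree's Dwork lemma). [cite: BlakestadGrant2023, §2.2 (K = R̂[1/p])] -/
theorem exists_natCast_pow_mul_mem_intSubring (x : completeRingQ) :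
    ∃ k : ℕ, ((3 : ℕ) : completeRingQ) ^ k * x ∈ intSubring :=
  exists_pow_mul_mem_intSubring x

section Extend

variable (α : completeRing →+* completeRing)

/-- A ring endomorphism of `R̂₃` preserves the powers of `3`. [folklore] -/
private theorem powers_le_comap : Submonoid.powers (3 : completeRing) ≤ (Submonoid.powers (3 : completeRing)).comap α := by
  rw [Submonoid.powers_le, Submonoid.mem_comap, map_ofNat]
  exact Submonoid.mem_powers _

/-- **The extension `α_K : K₃ → K₃`** of an endomorphism `α` of `R̂₃`. [cite: BlakestadGrant2023, Lemma 5] -/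
def extendQ : completeRingQ →+* completeRingQ :=
  IsLocalization.map completeRingQ α (powers_le_comap α)

/-- `α_K` restricted to `R̂₃` is `α`. [cite: BlakestadGrant2023, Def. 8] -/
theorem extendQ_algebraMap (x : completeRing) :
    extendQ α (algebraMap completeRing completeRingQ x) = algebraMap completeRing completeRingQ (α x) :=
  IsLocalization.map_eq (powers_le_comap α) x

/-- `α_K(R̂₃) ⊆ R̂₃`. [cite: BlakestadGrant2023, Def. 8] -/
theorem extendQ_mem_intSubring {r : completeRingQ} (hr : r ∈ intSubring) : extendQ α r ∈ intSubring := by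
  obtain ⟨x, rfl⟩ := hr
  exact ⟨α x, (extendQ_algebraMap α x).symm⟩

/-- If `α ≡` Frobenius `(mod 3)` on `R̂₃`, then `α_K(r) = r³ + 3·a` with `a ∈ R̂₃` for `r ∈ R̂₃`.
[cite: BlakestadGrant2023, Def. 8] -/
theorem exists_extendQ_eq_pow_add (hα : ∀ x, α x - x ^ 3 ∈ Ideal.span {(3 : completeRing)})
    {r : completeRingQ} (hr : r ∈ intSubring) :
    ∃ a ∈ intSubring, extendQ α r = r ^ 3 + 3 * a := by
  obtain ⟨x, rfl⟩ := hr
  obtain ⟨y, hy⟩ := Ideal.mem_span_singleton.mp (hα x)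
  refine ⟨algebraMap _ _ y, ⟨y, rfl⟩, ?_⟩
  rw [extendQ_algebraMap, eq_add_of_sub_eq hy, map_add, map_mul, map_pow, map_ofNat, add_comm]

/-- The same in the `((3 : ℕ) : K₃)`-form of the tree's Dwork lemma. [cite: BlakestadGrant2023, Def. 8] -/
theorem exists_extendQ_eq_pow_add' (hα : ∀ x, α x - x ^ 3 ∈ Ideal.span {(3 : completeRing)})
    {r : completeRingQ} (hr : r ∈ intSubring) :
    ∃ a ∈ intSubring, extendQ α r = r ^ (3 : ℕ) + ((3 : ℕ) : completeRingQ) * a :=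
  exists_extendQ_eq_pow_add α hα hr

end Extend

/-- Every nonzero natural number is a unit of `K₃`. [cite: BlakestadGrant2023, §2.2 (K = R̂[1/p])] -/
theorem isUnit_natCast_completeRingQ {n : ℕ} (hn : n ≠ 0) : IsUnit (n : completeRingQ) := by
  obtain ⟨k, m, hm, rfl⟩ := Nat.exists_eq_pow_mul_and_not_dvd hn 3 (by norm_num)
  rw [Nat.cast_mul, Nat.cast_pow]
  refine ((isUnit_three_completeRingQ).pow k).mul ?_
  have hmu : IsUnit (m : completeRing) :=
    isUnit_natCast_of_coprime (p := 3) ((Nat.Prime.coprime_iff_not_dvd Nat.prime_three).mpr hm).symm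
  simpa using hmu.map (algebraMap completeRing completeRingQ)

/-- Every nonzero integer is a unit of `K₃`. [cite: BlakestadGrant2023, §2.2 (K = R̂[1/p])] -/
theorem isUnit_intCast_completeRingQ {n : ℤ} (hn : n ≠ 0) : IsUnit (n : completeRingQ) := by
  have h : ((n.sign : ℤ) : completeRingQ) * (n : completeRingQ) = (n.natAbs : ℕ) := by
    rw [← Int.cast_mul, Int.sign_mul_self_eq_natAbs, Int.cast_natCast]
  have hu : IsUnit (((n.sign : ℤ) : completeRingQ) * (n : completeRingQ)) := by
    rw [h]
    exact isUnit_natCast_completeRingQ (Int.natAbs_ne_zero.mpr hn)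
  exact isUnit_of_mul_isUnit_right hu

/-- The ring map `ℚ → K₃`. [folklore] -/
def ratCast : ℚ →+* completeRingQ :=
  IsLocalization.lift (M := nonZeroDivisors ℤ) (S := ℚ) (g := Int.castRingHom completeRingQ)
    fun y => isUnit_intCast_completeRingQ (mem_nonZeroDivisors_iff_ne_zero.mp y.2)

/-- **`K₃` is a `ℚ`-algebra.** [folklore] -/
instance algebraRat_completeRingQ : Algebra ℚ completeRingQ := ratCast.toAlgebra

/-- `3 ≠ 0` in `R̂₃`. [cite: BlakestadGrant2023, §2.2 (K = R̂[1/p])] -/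
theorem three_ne_zero : (3 : completeRing) ≠ 0 := by
  intro h0
  have h1 : ((3 : ℕ) : completeRing) ^ 1 * 1 = 0 := by rw [pow_one, mul_one]; exact h0
  exact one_ne_zero ((pow_mul_eq_zero_iff_completeRing 1 1).mp h1)

/-- **`R̂₃ → K₃` is injective.** [cite: BlakestadGrant2023, Thm. 15] -/
theorem algebraMap_completeRingQ_injective : Function.Injective (algebraMap completeRing completeRingQ) :=
  IsLocalization.injective completeRingQ (powers_le_nonZeroDivisors_of_noZeroDivisors three_ne_zero)

/-- `K₃` is an integral domain. [folklore] -/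
instance isDomain_completeRingQ : IsDomain completeRingQ :=
  IsLocalization.isDomain_localization (powers_le_nonZeroDivisors_of_noZeroDivisors three_ne_zero)

/-- `R̂₃ → K₃` is injective on power series. [cite: BlakestadGrant2023, Thm. 15] -/
theorem powerSeries_map_algebraMap_injective :
    Function.Injective (PowerSeries.map (algebraMap completeRing completeRingQ)) :=
  PowerSeries.map_injective _ algebraMap_completeRingQ_injective

/-! ## Thm 2 over `R̂₃` and the `3`-adic side of specialisation -/

/-- **Blakestad–Grant's Thm 2 for the universal ordinary `a₂`-curve at `p = 3`**: there are `β ∈ R̂₃`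
and an EVEN series `Λ = 1 + ⋯ ∈ R̂₃⟦z⟧` with `zΛ' - Λ = -(X - βz²)·W_𝓔` (`Dζ = -x + β`, `ζ = Λ/z`).
[cite: BlakestadGrant2023, Thm. 2] -/
theorem exists_even_zetaSeries_universalCurve :
    ∃ β : completeRing, ∃ Λ : PowerSeries completeRing,
      constantCoeff Λ = 1 ∧ rescale (-1 : completeRing) Λ = Λ ∧
      X * d⁄dX completeRing Λ - Λ = -((universalCurve.formalXMulSq - C β * X ^ 2) * universalCurve.formalInvDiff) := by
  obtain ⟨β, hβ⟩ := universalCurve.exists_padicWeierstrassZetaConst 3 (by norm_num)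
    isUnit_coeff_formalInvDiff_universalCurve_pow
  obtain ⟨Λ₀, h0, hΛ₀, -⟩ := universalCurve.exists_padicWeierstrassZetaSeries hβ
  obtain ⟨hΛ₁, h0₁⟩ := zetaSeries_sub_C_mul_X hΛ₀ (coeff 1 Λ₀)
  refine ⟨β, Λ₀ - C (coeff 1 Λ₀) * X, by rw [h0₁, h0], ?_, hΛ₁⟩
  refine rescale_neg_one_eq_self_of_zetaSeries hΛ₁ (universalCurve.rescale_neg_one_formalXMulSq_sub_mul_formalInvDiff β) ?_
  rw [map_sub, coeff_C_mul, coeff_one_X, mul_one, sub_self]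

/-- **`ρ` extends to `K₃`**: a ring map `ρ : R̂₃ → ℤ₃` induces `ρ_K : K₃ → ℚ₃` with `ρ_K|_{R̂₃} = ρ`.
[cite: BlakestadGrant2023, Thm. 15] -/
theorem exists_ringHom_completeRingQ_padic (ρ : completeRing →+* ℤ_[3]) :
    ∃ ρK : completeRingQ →+* ℚ_[3], ∀ x, ρK (algebraMap completeRing completeRingQ x) = ((ρ x : ℤ_[3]) : ℚ_[3]) := by
  have hu : IsUnit (((PadicInt.Coe.ringHom (p := 3)).comp ρ) (3 : completeRing)) := by
    rw [map_ofNat]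
    exact isUnit_iff_ne_zero.mpr (by norm_num)
  refine ⟨IsLocalization.Away.lift (3 : completeRing) hu, fun x => ?_⟩
  rw [IsLocalization.Away.lift_eq]
  rfl

/-- Coefficients in `R̂₃ ⊆ K₃` specialise to `3`-integral elements of `ℚ₃`. [cite: BlakestadGrant2023, Thm. 15] -/
theorem norm_le_one_of_mem_intSubring {ρ : completeRing →+* ℤ_[3]} {ρK : completeRingQ →+* ℚ_[3]}
    (hρK : ∀ x, ρK (algebraMap completeRing completeRingQ x) = ((ρ x : ℤ_[3]) : ℚ_[3]))
    {c : completeRingQ} (hc : c ∈ intSubring) : ‖ρK c‖ ≤ 1 := by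
  obtain ⟨x, rfl⟩ := hc
  rw [hρK, ← PadicInt.norm_def]
  exact PadicInt.norm_le_one _

end Literature.NumberTheory.EllipticCurves.PadicSigmaThree.Universal

end

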